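import Summits.AnomalousDissipation.AnomalousDissipation.Theses.VirtualDissipation
import Summits.AnomalousDissipation.AnomalousDissipation.Theorems.TaylorCertificatesSteadyStatesLoudBoundedStubCompactnessSplit
import Summits.AnomalousDissipation.AnomalousDissipation.Theorems.TaylorCertificatesSteadyStatesLoudBoundedStubGpAdmissible
import Summits.AnomalousDissipation.AnomalousDissipation.Theorems.TaylorCertificatesSteadyStatesLoudBoundedStubBadSeqStrongLimit
import HarnessLib

/-!
# Line `conservative-cut` (strategist ALT line) — crux `VirtualDissipation.LambRigidGP` (stmt-AnomalousDissipation-15150)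

Route `route-AnomalousDissipation-VirtualDissipation`, crux #2: ν-free Lamb rigidity of the Galloway–Proctor force
`f_GP(x) = sin(2πx₃)e₁ + sin(2πx₁)e₂ + sin(2πx₂)e₃` at the energy level `E = 2` (the crux is antitone in `E`, so its
`E = 2` instance is the whole crux).  Registered skeleton of the crux: `Lines/birth.lean` (Q = `stub_noQuietVStateGP`,
D = `stub_noOnsagerDodgerGP`, composed by the landed `stub_compactnessSplit`).  THIS FILE DOES NOT TOUCH IT; it is an
ALTERNATIVE line (crux-strategist `planner-cstrat-stmt-AnomalousDissipation-15150-s1-0`, 2026-08-17) whose stubs are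
registered by `ledger workitem stub-add` next to birth's.

IDEA (the L²-cut, = lead c1's dichotomy P1 of the sibling crux 13038 made into a checked skeleton for THIS crux).
Birth cuts the bad sequences of the crux at `H¹` (bounded enstrophy ⇒ Rellich ⇒ a `V`-state, enemy Q; divergent
enstrophy = enemy D, "no Onsager dodger", the load-bearing stub with no tool in print).  Here the hardest stub D is
DECOMPOSED along the `L²` dichotomy instead, with a kernel-checked join:

* `stub_badSeqPrecompactGP` (P) — LEVEL-2 BAD SEQUENCES ARE `L²`-PRECOMPACT: every bad sequence of `f_GP` at level 2
  (admissible `u_n`, `∫|u_n|² ≤ 2`, residual bounds `R_n → 0`, vanishing virtual dissipation `R_n √(gradNormSq u_n) → 0`)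
  has a subsequence converging STRONGLY in `L²` to some `v ∈ L²` with `∫|v|² ≤ 2`.  This is the MICROSTRUCTURE exclusion
  ("vanishing virtual dissipation kills persistent oscillations"): strictly weaker than D (D + Rellich ⇒ P), believed
  for EVERY force and level (one-scale and finitely-many-scale oscillatory bad sequences have a virtual-dissipation FLOOR,
  lead c1 P1; only an Onsager-SUPERcritical stationary h-principle — not in print: stationary convex integration is `L^∞`
  (Choffrut–Székelyhidi arXiv:1401.4301) or `C^α` for SOME small `α` unforced (arXiv:2501.13632) — would refute it), and it
  is exactly the statement concentration-compactness / defect-measure / two-scale tools speak to.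
* `stub_noRoughStandingLimitGP` (L) — NO ROUGH CONSERVATIVE STANDING FLOW OF `f_GP` IN THE CLOSED 2-BALL ARISES AS A
  DODGER LIMIT: there is no `v ∈ L²`, `∫|v|² ≤ 2`, doing zero work (`(f_GP, v) = 0`) and solving steady Euler weakly
  (`∫⟪v, Dw·v⟫ + (f_GP, w) = 0` for all admissible `w`) which is the strong `L²` limit of a level-2 bad sequence WITH
  DIVERGENT ENSTROPHY.  This is the `f_GP`-specific Liouville piece and names the true enemies of the crux: vortex-SHEET
  standing flows obtained from torus-carrying exact DRIFT solutions `V = d + W` of `f_GP` by signing invariant bands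
  (Theorem A of `Cruxes/SteadyStatesLoudBounded/Lines/lamb-floor-f123-shared-ceiling-S1-dodgers.md`; its Kolmogorov
  instance is kernel-checked, p118014), and `C^σ`, `σ ∈ (1/3, 1)`, non-`H¹` standing flows (mollify).  For the sibling
  force `f₁₂₃` such sheets EXIST above total energy `4.05` (kit j020769/j021330); for `f_GP` the linear-response drift
  family along `(1,1,1)` has total energy `3s² + 3/(8π²s²) < 2` for every `s < 0.81`, so (L) — and with it D and the crux —
  lives iff the exact torus-carrying drift branches of `f_GP` END above total energy `2` (strategist kit job j023272
  measures this; nothing for `f_GP` existed before).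
* `stub_noQuietVStateGP` (Q) — verbatim birth's Q (same name, same signature: ONE registered obligation serves both
  lines): no finite-enstrophy weak steady Euler state of `f_GP` in the closed 2-ball.

COMPOSITION (sorry-free, axioms propext / Classical.choice / Quot.sound):
`noOnsagerDodgerGP_of : P → L → D` (a bad sequence that is not frequently enstrophy-bounded is, along the `L²`-convergent
subsequence given by P, a DODGER converging strongly to `v`; the landed `stub_badSeqStrongLimit` (p-accepted tools
lemma of line lamb-floor-f123-shared-ceiling) makes `v` a zero-work weak standing flow; L says no) and
`LambRigidGP_of : Q → P → L → LambRigidGP` (birth's join: landed `stub_compactnessSplit` p85561 at `f := f_GP`, `E := 2`,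
smoothness of `f_GP` from the landed `stub_gpAdmissible` p85210; witness `E := 2`).

So `LambRigidGP ⟸ Q ∧ P ∧ L`, and conversely `D ⇒ P` (Rellich) and `D ⇒ L` (trivially), i.e. `{P, L}` is an honest
split of D, not a reweighting: P is force-agnostic structure, L is the force-and-level-sensitive Liouville statement that
the sheet-dodger mechanism attacks.  Why this dodges the goal birth's lead will be stuck on: a proof of D must exclude, BY
MICROSTRUCTURE TOOLS, objects that are not microstructures at all (strongly convergent dodgers: mollified sheets,
`C^{σ>1/3}` flows); here those go to L, where energy/work identities, drift-solution energetics and analyticity apply, and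
P keeps only the oscillation-killing content.

Imports: the route file; the landed Theorems files `…StubCompactnessSplit` (p85561), `…StubGpAdmissible` (p85210),
`…StubBadSeqStrongLimit` (tools lemma, crux 13038); HarnessLib.  Lives under `Cruxes/` — the route file's cone is untouched.
Disproof used: none exists for this crux (`ledger crux ls`, 2026-08-17); nearest: the sibling's Theorem A (what L must beat).
-/

-- `Summit.<Summit>.<Problem>` is the tree's mandated summit-side namespace (CONVENTIONS §2); single-conjunct summit, duplicate deliberate.
set_option linter.dupNamespace false

noncomputable section

namespace Summit.AnomalousDissipation.AnomalousDissipation.Cruxes.LambRigidGP.ConservativeCut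

open MeasureTheory Filter Topology UnitAddTorus
open scoped InnerProductSpace ENNReal

/-! ## Stubs -/

/-- **(Q) `stub_noQuietVStateGP`** — verbatim the Q stub of `Lines/birth.lean` (shared obligation): no finite-enstrophy
weak steady Euler state of `f_GP` in the closed energy ball of level 2.  Open; size L–XL.
[FoiasManleyRosaTemam2001, Ch. II §7; arXiv:1401.4301; arXiv:2501.13632] -/
theorem stub_noQuietVStateGP :
    ∀ u : Literature.Analysis.FunctionSpaces.Torus.energySpace (Fin 3),
      (u : Lp (EuclideanSpace ℝ (Fin 3)) 2 (volume : Measure (UnitAddTorus (Fin 3)))) ∈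
          Literature.Analysis.FunctionSpaces.Torus.energySpaceV (Fin 3) →
        Literature.Analysis.FluidPDE.Torus.IsSteadyWeakSolution 0
          (fun x : UnitAddTorus (Fin 3) => (Literature.Analysis.FluidPDE.Torus.stokesMode (Pi.single (2 : Fin 3) (1 : ℤ)) (EuclideanSpace.single (0 : Fin 3) (1 : ℝ)) false x + Literature.Analysis.FluidPDE.Torus.stokesMode (Pi.single (0 : Fin 3) (1 : ℤ)) (EuclideanSpace.single (1 : Fin 3) (1 : ℝ)) false x + Literature.Analysis.FluidPDE.Torus.stokesMode (Pi.single (1 : Fin 3) (1 : ℤ)) (EuclideanSpace.single (2 : Fin 3) (1 : ℝ)) false x : EuclideanSpace ℝ (Fin 3))) u →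
        2 < ‖u‖ ^ 2 := by
  sorry

/-- **(P) `stub_badSeqPrecompactGP`** — LEVEL-2 BAD SEQUENCES OF `f_GP` ARE `L²`-PRECOMPACT: a bad sequence (admissible
`u_n`, `∫|u_n|² ≤ 2`, residual bounds `R_n ≥ 0` of `w ↦ ∫⟪(u_n·∇)u_n − f_GP, w⟫` dual to `‖∇w‖₂`, `R_n → 0`,
`R_n √(gradNormSq u_n) → 0`) has a subsequence converging strongly in `L²` to some `v ∈ L²` with `∫|v|² ≤ 2`.
The microstructure-exclusion piece (strictly weaker than birth's D); open, size L–XL; believed force-agnostic.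
First cuts: lead c1's P1 bookkeeping (one-scale ensembles `U + A Σ a_k φ_k(λx)B_k` have `R‖∇u‖ ≍ A³‖∇a²‖`), the
no-local-virtual-work inequality `|∫ φ⟪PΛu − f, u⟫| ≤ R(‖∇φ‖_∞‖u‖₂ + ‖φ‖_∞‖∇u‖₂)` (test `w = P[φu]`), profile
decomposition on `T³` (failure of precompactness = mass `η > 0` escaping to frequencies `K_n → ∞`).
[arXiv:1401.4301; arXiv:2501.13632; arXiv:2405.08390; Cruxes/SteadyStatesLoudBounded/Lines/lamb-floor-f123-shared-ceiling-S1-c1.md §P1] -/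
theorem stub_badSeqPrecompactGP :
    ∀ (u : ℕ → UnitAddTorus (Fin 3) → EuclideanSpace ℝ (Fin 3)) (R : ℕ → ℝ),
      (∀ n : ℕ, Literature.Analysis.FunctionSpaces.Torus.IsSmooth (u n) ∧
          Literature.Analysis.FunctionSpaces.Torus.IsDivFree (u n) ∧
          Literature.Analysis.FunctionSpaces.Torus.HasZeroMean (u n) ∧
          ∫ x, ‖u n x‖ ^ 2 ≤ (2 : ℝ) ∧ 0 ≤ R n ∧
          ∀ w : UnitAddTorus (Fin 3) → EuclideanSpace ℝ (Fin 3),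
            Literature.Analysis.FunctionSpaces.Torus.IsSmooth w → Literature.Analysis.FunctionSpaces.Torus.IsDivFree w →
            Literature.Analysis.FunctionSpaces.Torus.HasZeroMean w →
            |∫ x, inner ℝ (Literature.Analysis.FunctionSpaces.Torus.convect (u n) (u n) x - (Literature.Analysis.FluidPDE.Torus.stokesMode (Pi.single (2 : Fin 3) (1 : ℤ)) (EuclideanSpace.single (0 : Fin 3) (1 : ℝ)) false x + Literature.Analysis.FluidPDE.Torus.stokesMode (Pi.single (0 : Fin 3) (1 : ℤ)) (EuclideanSpace.single (1 : Fin 3) (1 : ℝ)) false x + Literature.Analysis.FluidPDE.Torus.stokesMode (Pi.single (1 : Fin 3) (1 : ℤ)) (EuclideanSpace.single (2 : Fin 3) (1 : ℝ)) false x : EuclideanSpace ℝ (Fin 3))) (w x)| ≤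
              R n * Real.sqrt (Literature.Analysis.FunctionSpaces.Torus.gradNormSq w)) →
      Filter.Tendsto R Filter.atTop (nhds 0) →
      Filter.Tendsto (fun n => R n * Real.sqrt (Literature.Analysis.FunctionSpaces.Torus.gradNormSq (u n))) Filter.atTop (nhds 0) →
      ∃ (φ : ℕ → ℕ) (v : UnitAddTorus (Fin 3) → EuclideanSpace ℝ (Fin 3)), StrictMono φ ∧
        MeasureTheory.MemLp v 2 (volume : Measure (UnitAddTorus (Fin 3))) ∧ ∫ x, ‖v x‖ ^ 2 ≤ (2 : ℝ) ∧
        Filter.Tendsto (fun n => ∫ x, ‖u (φ n) x - v x‖ ^ 2) Filter.atTop (nhds 0) := by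
  sorry

/-- **(L) `stub_noRoughStandingLimitGP`** — NO ROUGH CONSERVATIVE STANDING FLOW OF `f_GP` IN THE CLOSED 2-BALL IS A DODGER
LIMIT: there is no `v ∈ L²` with `∫|v|² ≤ 2`, zero work `(f_GP, v) = 0`, solving steady Euler weakly
(`∫⟪v, Dw·v⟫ + (f_GP, w) = 0` for every admissible `w`), which is the strong `L²` limit of a level-2 bad sequence with
DIVERGENT enstrophy (`∀ B, eventually B < gradNormSq u_n`).  The `f_GP`-specific Liouville piece; open, size XL.  Enemies it
must exclude: vortex-sheet standing flows `S·V` from torus-carrying exact drift solutions `V = d + W` of `f_GP` with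
`∫|V|² ≤ 2` (Theorem A of the sibling crux; for `f_GP` the linear-response family along `(1,1,1)` has energy
`3s² + 3/(8π²s²) < 2` for all `s < 0.81`, the exact branches are measured by kit j023272), and `C^{σ∈(1/3,1)} ∖ H¹`
standing flows of `f_GP` in the ball.  Handles: `(f_GP, v) = 0`; the 12 first-shell moment identities
`∫ v⊗v : ∇w = −(f_GP, w)`; analyticity/curl test of `f_GP` (`curl f_GP = 2π(cos 2πx₂, cos 2πx₃, cos 2πx₁)` has linearly
independent components, so no patchwork of single-family laminates reaches `f_GP`); drift-solution energetics.
[Cruxes/SteadyStatesLoudBounded/Lines/lamb-floor-f123-shared-ceiling-S1-dodgers.md; arXiv:1401.4301; Temam1979] -/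
theorem stub_noRoughStandingLimitGP :
    ∀ v : UnitAddTorus (Fin 3) → EuclideanSpace ℝ (Fin 3),
      MeasureTheory.MemLp v 2 (volume : Measure (UnitAddTorus (Fin 3))) → ∫ x, ‖v x‖ ^ 2 ≤ (2 : ℝ) →
      (∫ x, inner ℝ (Literature.Analysis.FluidPDE.Torus.stokesMode (Pi.single (2 : Fin 3) (1 : ℤ)) (EuclideanSpace.single (0 : Fin 3) (1 : ℝ)) false x + Literature.Analysis.FluidPDE.Torus.stokesMode (Pi.single (0 : Fin 3) (1 : ℤ)) (EuclideanSpace.single (1 : Fin 3) (1 : ℝ)) false x + Literature.Analysis.FluidPDE.Torus.stokesMode (Pi.single (1 : Fin 3) (1 : ℤ)) (EuclideanSpace.single (2 : Fin 3) (1 : ℝ)) false x : EuclideanSpace ℝ (Fin 3)) (v x) = 0) →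
      (∀ w : UnitAddTorus (Fin 3) → EuclideanSpace ℝ (Fin 3),
          Literature.Analysis.FunctionSpaces.Torus.IsSmooth w → Literature.Analysis.FunctionSpaces.Torus.IsDivFree w →
          Literature.Analysis.FunctionSpaces.Torus.HasZeroMean w →
          (∫ x, inner ℝ (v x) (Literature.Analysis.FunctionSpaces.Torus.fderiv w x (v x))) +
            ∫ x, inner ℝ (Literature.Analysis.FluidPDE.Torus.stokesMode (Pi.single (2 : Fin 3) (1 : ℤ)) (EuclideanSpace.single (0 : Fin 3) (1 : ℝ)) false x + Literature.Analysis.FluidPDE.Torus.stokesMode (Pi.single (0 : Fin 3) (1 : ℤ)) (EuclideanSpace.single (1 : Fin 3) (1 : ℝ)) false x + Literature.Analysis.FluidPDE.Torus.stokesMode (Pi.single (1 : Fin 3) (1 : ℤ)) (EuclideanSpace.single (2 : Fin 3) (1 : ℝ)) false x : EuclideanSpace ℝ (Fin 3)) (w x) = 0) →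
      (∃ (u : ℕ → UnitAddTorus (Fin 3) → EuclideanSpace ℝ (Fin 3)) (R : ℕ → ℝ),
          (∀ n : ℕ, Literature.Analysis.FunctionSpaces.Torus.IsSmooth (u n) ∧
              Literature.Analysis.FunctionSpaces.Torus.IsDivFree (u n) ∧
              Literature.Analysis.FunctionSpaces.Torus.HasZeroMean (u n) ∧
              ∫ x, ‖u n x‖ ^ 2 ≤ (2 : ℝ) ∧ 0 ≤ R n ∧
              ∀ w : UnitAddTorus (Fin 3) → EuclideanSpace ℝ (Fin 3),
                Literature.Analysis.FunctionSpaces.Torus.IsSmooth w → Literature.Analysis.FunctionSpaces.Torus.IsDivFree w →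
                Literature.Analysis.FunctionSpaces.Torus.HasZeroMean w →
                |∫ x, inner ℝ (Literature.Analysis.FunctionSpaces.Torus.convect (u n) (u n) x - (Literature.Analysis.FluidPDE.Torus.stokesMode (Pi.single (2 : Fin 3) (1 : ℤ)) (EuclideanSpace.single (0 : Fin 3) (1 : ℝ)) false x + Literature.Analysis.FluidPDE.Torus.stokesMode (Pi.single (0 : Fin 3) (1 : ℤ)) (EuclideanSpace.single (1 : Fin 3) (1 : ℝ)) false x + Literature.Analysis.FluidPDE.Torus.stokesMode (Pi.single (1 : Fin 3) (1 : ℤ)) (EuclideanSpace.single (2 : Fin 3) (1 : ℝ)) false x : EuclideanSpace ℝ (Fin 3))) (w x)| ≤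
                  R n * Real.sqrt (Literature.Analysis.FunctionSpaces.Torus.gradNormSq w)) ∧
          Filter.Tendsto R Filter.atTop (nhds 0) ∧
          Filter.Tendsto (fun n => R n * Real.sqrt (Literature.Analysis.FunctionSpaces.Torus.gradNormSq (u n))) Filter.atTop (nhds 0) ∧
          (∀ B : ℝ, ∃ N : ℕ, ∀ n : ℕ, N ≤ n → B < Literature.Analysis.FunctionSpaces.Torus.gradNormSq (u n)) ∧
          Filter.Tendsto (fun n => ∫ x, ‖u n x - v x‖ ^ 2) Filter.atTop (nhds 0)) →
      False := by
  sorry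

/-! ## Name-keyed aliases of the stub statements (device of `Lines/birth.lean`): the hypotheses of the compositions -/
namespace __Registered

/-- Alias of the statement of `stub_noQuietVStateGP`, keyed by the stub name. -/
abbrev stub_noQuietVStateGP : Prop :=
  ∀ u : Literature.Analysis.FunctionSpaces.Torus.energySpace (Fin 3),
      (u : Lp (EuclideanSpace ℝ (Fin 3)) 2 (volume : Measure (UnitAddTorus (Fin 3)))) ∈
          Literature.Analysis.FunctionSpaces.Torus.energySpaceV (Fin 3) →
        Literature.Analysis.FluidPDE.Torus.IsSteadyWeakSolution 0
          (fun x : UnitAddTorus (Fin 3) => (Literature.Analysis.FluidPDE.Torus.stokesMode (Pi.single (2 : Fin 3) (1 : ℤ)) (EuclideanSpace.single (0 : Fin 3) (1 : ℝ)) false x + Literature.Analysis.FluidPDE.Torus.stokesMode (Pi.single (0 : Fin 3) (1 : ℤ)) (EuclideanSpace.single (1 : Fin 3) (1 : ℝ)) false x + Literature.Analysis.FluidPDE.Torus.stokesMode (Pi.single (1 : Fin 3) (1 : ℤ)) (EuclideanSpace.single (2 : Fin 3) (1 : ℝ)) false x : EuclideanSpace ℝ (Fin 3))) u →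
        2 < ‖u‖ ^ 2

/-- Alias of the statement of `stub_badSeqPrecompactGP`, keyed by the stub name. -/
abbrev stub_badSeqPrecompactGP : Prop :=
  ∀ (u : ℕ → UnitAddTorus (Fin 3) → EuclideanSpace ℝ (Fin 3)) (R : ℕ → ℝ),
      (∀ n : ℕ, Literature.Analysis.FunctionSpaces.Torus.IsSmooth (u n) ∧
          Literature.Analysis.FunctionSpaces.Torus.IsDivFree (u n) ∧
          Literature.Analysis.FunctionSpaces.Torus.HasZeroMean (u n) ∧
          ∫ x, ‖u n x‖ ^ 2 ≤ (2 : ℝ) ∧ 0 ≤ R n ∧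
          ∀ w : UnitAddTorus (Fin 3) → EuclideanSpace ℝ (Fin 3),
            Literature.Analysis.FunctionSpaces.Torus.IsSmooth w → Literature.Analysis.FunctionSpaces.Torus.IsDivFree w →
            Literature.Analysis.FunctionSpaces.Torus.HasZeroMean w →
            |∫ x, inner ℝ (Literature.Analysis.FunctionSpaces.Torus.convect (u n) (u n) x - (Literature.Analysis.FluidPDE.Torus.stokesMode (Pi.single (2 : Fin 3) (1 : ℤ)) (EuclideanSpace.single (0 : Fin 3) (1 : ℝ)) false x + Literature.Analysis.FluidPDE.Torus.stokesMode (Pi.single (0 : Fin 3) (1 : ℤ)) (EuclideanSpace.single (1 : Fin 3) (1 : ℝ)) false x + Literature.Analysis.FluidPDE.Torus.stokesMode (Pi.single (1 : Fin 3) (1 : ℤ)) (EuclideanSpace.single (2 : Fin 3) (1 : ℝ)) false x : EuclideanSpace ℝ (Fin 3))) (w x)| ≤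
              R n * Real.sqrt (Literature.Analysis.FunctionSpaces.Torus.gradNormSq w)) →
      Filter.Tendsto R Filter.atTop (nhds 0) →
      Filter.Tendsto (fun n => R n * Real.sqrt (Literature.Analysis.FunctionSpaces.Torus.gradNormSq (u n))) Filter.atTop (nhds 0) →
      ∃ (φ : ℕ → ℕ) (v : UnitAddTorus (Fin 3) → EuclideanSpace ℝ (Fin 3)), StrictMono φ ∧
        MeasureTheory.MemLp v 2 (volume : Measure (UnitAddTorus (Fin 3))) ∧ ∫ x, ‖v x‖ ^ 2 ≤ (2 : ℝ) ∧
        Filter.Tendsto (fun n => ∫ x, ‖u (φ n) x - v x‖ ^ 2) Filter.atTop (nhds 0)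

/-- Alias of the statement of `stub_noRoughStandingLimitGP`, keyed by the stub name. -/
abbrev stub_noRoughStandingLimitGP : Prop :=
  ∀ v : UnitAddTorus (Fin 3) → EuclideanSpace ℝ (Fin 3),
      MeasureTheory.MemLp v 2 (volume : Measure (UnitAddTorus (Fin 3))) → ∫ x, ‖v x‖ ^ 2 ≤ (2 : ℝ) →
      (∫ x, inner ℝ (Literature.Analysis.FluidPDE.Torus.stokesMode (Pi.single (2 : Fin 3) (1 : ℤ)) (EuclideanSpace.single (0 : Fin 3) (1 : ℝ)) false x + Literature.Analysis.FluidPDE.Torus.stokesMode (Pi.single (0 : Fin 3) (1 : ℤ)) (EuclideanSpace.single (1 : Fin 3) (1 : ℝ)) false x + Literature.Analysis.FluidPDE.Torus.stokesMode (Pi.single (1 : Fin 3) (1 : ℤ)) (EuclideanSpace.single (2 : Fin 3) (1 : ℝ)) false x : EuclideanSpace ℝ (Fin 3)) (v x) = 0) →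
      (∀ w : UnitAddTorus (Fin 3) → EuclideanSpace ℝ (Fin 3),
          Literature.Analysis.FunctionSpaces.Torus.IsSmooth w → Literature.Analysis.FunctionSpaces.Torus.IsDivFree w →
          Literature.Analysis.FunctionSpaces.Torus.HasZeroMean w →
          (∫ x, inner ℝ (v x) (Literature.Analysis.FunctionSpaces.Torus.fderiv w x (v x))) +
            ∫ x, inner ℝ (Literature.Analysis.FluidPDE.Torus.stokesMode (Pi.single (2 : Fin 3) (1 : ℤ)) (EuclideanSpace.single (0 : Fin 3) (1 : ℝ)) false x + Literature.Analysis.FluidPDE.Torus.stokesMode (Pi.single (0 : Fin 3) (1 : ℤ)) (EuclideanSpace.single (1 : Fin 3) (1 : ℝ)) false x + Literature.Analysis.FluidPDE.Torus.stokesMode (Pi.single (1 : Fin 3) (1 : ℤ)) (EuclideanSpace.single (2 : Fin 3) (1 : ℝ)) false x : EuclideanSpace ℝ (Fin 3)) (w x) = 0) →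
      (∃ (u : ℕ → UnitAddTorus (Fin 3) → EuclideanSpace ℝ (Fin 3)) (R : ℕ → ℝ),
          (∀ n : ℕ, Literature.Analysis.FunctionSpaces.Torus.IsSmooth (u n) ∧
              Literature.Analysis.FunctionSpaces.Torus.IsDivFree (u n) ∧
              Literature.Analysis.FunctionSpaces.Torus.HasZeroMean (u n) ∧
              ∫ x, ‖u n x‖ ^ 2 ≤ (2 : ℝ) ∧ 0 ≤ R n ∧
              ∀ w : UnitAddTorus (Fin 3) → EuclideanSpace ℝ (Fin 3),
                Literature.Analysis.FunctionSpaces.Torus.IsSmooth w → Literature.Analysis.FunctionSpaces.Torus.IsDivFree w →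
                Literature.Analysis.FunctionSpaces.Torus.HasZeroMean w →
                |∫ x, inner ℝ (Literature.Analysis.FunctionSpaces.Torus.convect (u n) (u n) x - (Literature.Analysis.FluidPDE.Torus.stokesMode (Pi.single (2 : Fin 3) (1 : ℤ)) (EuclideanSpace.single (0 : Fin 3) (1 : ℝ)) false x + Literature.Analysis.FluidPDE.Torus.stokesMode (Pi.single (0 : Fin 3) (1 : ℤ)) (EuclideanSpace.single (1 : Fin 3) (1 : ℝ)) false x + Literature.Analysis.FluidPDE.Torus.stokesMode (Pi.single (1 : Fin 3) (1 : ℤ)) (EuclideanSpace.single (2 : Fin 3) (1 : ℝ)) false x : EuclideanSpace ℝ (Fin 3))) (w x)| ≤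
                  R n * Real.sqrt (Literature.Analysis.FunctionSpaces.Torus.gradNormSq w)) ∧
          Filter.Tendsto R Filter.atTop (nhds 0) ∧
          Filter.Tendsto (fun n => R n * Real.sqrt (Literature.Analysis.FunctionSpaces.Torus.gradNormSq (u n))) Filter.atTop (nhds 0) ∧
          (∀ B : ℝ, ∃ N : ℕ, ∀ n : ℕ, N ≤ n → B < Literature.Analysis.FunctionSpaces.Torus.gradNormSq (u n)) ∧
          Filter.Tendsto (fun n => ∫ x, ‖u n x - v x‖ ^ 2) Filter.atTop (nhds 0)) →
      False

end __Registered

/-! ## Compositions -/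

/-- **The split of birth's D**: `L²`-precompactness of level-2 bad sequences (P) and the absence of rough conservative
standing-flow limits (L) imply that every level-2 bad sequence of `f_GP` is frequently enstrophy-bounded — literally the
statement of `Lines/birth.lean`'s `stub_noOnsagerDodgerGP`.  Proof: a bad sequence that is NOT frequently bounded has
`gradNormSq u_n → ∞`; along the `L²`-convergent subsequence of (P) it is still bad and still divergent, its limit `v`
does zero work and solves steady Euler weakly by the landed `stub_badSeqStrongLimit`, and (L) forbids exactly this. -/
theorem noOnsagerDodgerGP_of (hP : __Registered.stub_badSeqPrecompactGP)
    (hL : __Registered.stub_noRoughStandingLimitGP) :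
    ∀ (u : ℕ → UnitAddTorus (Fin 3) → EuclideanSpace ℝ (Fin 3)) (R : ℕ → ℝ),
      (∀ n : ℕ, Literature.Analysis.FunctionSpaces.Torus.IsSmooth (u n) ∧
          Literature.Analysis.FunctionSpaces.Torus.IsDivFree (u n) ∧
          Literature.Analysis.FunctionSpaces.Torus.HasZeroMean (u n) ∧
          ∫ x, ‖u n x‖ ^ 2 ≤ (2 : ℝ) ∧ 0 ≤ R n ∧
          ∀ w : UnitAddTorus (Fin 3) → EuclideanSpace ℝ (Fin 3),
            Literature.Analysis.FunctionSpaces.Torus.IsSmooth w → Literature.Analysis.FunctionSpaces.Torus.IsDivFree w →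
            Literature.Analysis.FunctionSpaces.Torus.HasZeroMean w →
            |∫ x, inner ℝ (Literature.Analysis.FunctionSpaces.Torus.convect (u n) (u n) x - (Literature.Analysis.FluidPDE.Torus.stokesMode (Pi.single (2 : Fin 3) (1 : ℤ)) (EuclideanSpace.single (0 : Fin 3) (1 : ℝ)) false x + Literature.Analysis.FluidPDE.Torus.stokesMode (Pi.single (0 : Fin 3) (1 : ℤ)) (EuclideanSpace.single (1 : Fin 3) (1 : ℝ)) false x + Literature.Analysis.FluidPDE.Torus.stokesMode (Pi.single (1 : Fin 3) (1 : ℤ)) (EuclideanSpace.single (2 : Fin 3) (1 : ℝ)) false x : EuclideanSpace ℝ (Fin 3))) (w x)| ≤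
              R n * Real.sqrt (Literature.Analysis.FunctionSpaces.Torus.gradNormSq w)) →
      Filter.Tendsto R Filter.atTop (nhds 0) →
      Filter.Tendsto (fun n => R n * Real.sqrt (Literature.Analysis.FunctionSpaces.Torus.gradNormSq (u n))) Filter.atTop (nhds 0) →
      ∃ B : ℝ, ∀ N : ℕ, ∃ n : ℕ, N ≤ n ∧ Literature.Analysis.FunctionSpaces.Torus.gradNormSq (u n) ≤ B := by
  dsimp only [__Registered.stub_badSeqPrecompactGP, __Registered.stub_noRoughStandingLimitGP] at hP hL
  intro u R hbad hR hRG
  by_contra hD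
  push Not at hD
  -- hD : ∀ B, ∃ N, ∀ n, N ≤ n → B < gradNormSq (u n)
  obtain ⟨φ, v, hφ, hv, hv2, hconv⟩ := hP u R hbad hR hRG
  have hφt : Filter.Tendsto φ Filter.atTop Filter.atTop := hφ.tendsto_atTop
  obtain ⟨hfs, -, -⟩ :=
    Summit.AnomalousDissipation.AnomalousDissipation.Theorems.SteadyStatesLoudBounded.GpAdmissible.stub_gpAdmissible
  have hseq : ∀ n : ℕ, Literature.Analysis.FunctionSpaces.Torus.IsSmooth (u (φ n)) ∧
      Literature.Analysis.FunctionSpaces.Torus.IsDivFree (u (φ n)) ∧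
      Literature.Analysis.FunctionSpaces.Torus.HasZeroMean (u (φ n)) ∧ 0 ≤ R (φ n) ∧
      ∀ w : UnitAddTorus (Fin 3) → EuclideanSpace ℝ (Fin 3),
        Literature.Analysis.FunctionSpaces.Torus.IsSmooth w → Literature.Analysis.FunctionSpaces.Torus.IsDivFree w →
        Literature.Analysis.FunctionSpaces.Torus.HasZeroMean w →
        |∫ x, inner ℝ (Literature.Analysis.FunctionSpaces.Torus.convect (u (φ n)) (u (φ n)) x -
            (fun x : UnitAddTorus (Fin 3) => (Literature.Analysis.FluidPDE.Torus.stokesMode (Pi.single (2 : Fin 3) (1 : ℤ)) (EuclideanSpace.single (0 : Fin 3) (1 : ℝ)) false x + Literature.Analysis.FluidPDE.Torus.stokesMode (Pi.single (0 : Fin 3) (1 : ℤ)) (EuclideanSpace.single (1 : Fin 3) (1 : ℝ)) false x + Literature.Analysis.FluidPDE.Torus.stokesMode (Pi.single (1 : Fin 3) (1 : ℤ)) (EuclideanSpace.single (2 : Fin 3) (1 : ℝ)) false x : EuclideanSpace ℝ (Fin 3))) x) (w x)| ≤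
          R (φ n) * Real.sqrt (Literature.Analysis.FunctionSpaces.Torus.gradNormSq w) := fun n =>
    ⟨(hbad (φ n)).1, (hbad (φ n)).2.1, (hbad (φ n)).2.2.1, (hbad (φ n)).2.2.2.2.1, (hbad (φ n)).2.2.2.2.2⟩
  obtain ⟨hwork, hweak⟩ :=
    Summit.AnomalousDissipation.AnomalousDissipation.Theorems.SteadyStatesLoudBounded.BadSeqStrongLimit.stub_badSeqStrongLimit
      (fun x : UnitAddTorus (Fin 3) => (Literature.Analysis.FluidPDE.Torus.stokesMode (Pi.single (2 : Fin 3) (1 : ℤ)) (EuclideanSpace.single (0 : Fin 3) (1 : ℝ)) false x + Literature.Analysis.FluidPDE.Torus.stokesMode (Pi.single (0 : Fin 3) (1 : ℤ)) (EuclideanSpace.single (1 : Fin 3) (1 : ℝ)) false x + Literature.Analysis.FluidPDE.Torus.stokesMode (Pi.single (1 : Fin 3) (1 : ℤ)) (EuclideanSpace.single (2 : Fin 3) (1 : ℝ)) false x : EuclideanSpace ℝ (Fin 3)))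
      v (fun n => u (φ n)) (fun n => R (φ n)) hfs hseq (hR.comp hφt) (hRG.comp hφt) hv hconv
  refine hL v hv hv2 hwork hweak ⟨fun n => u (φ n), fun n => R (φ n), fun n => hbad (φ n), hR.comp hφt,
    hRG.comp hφt, ?_, hconv⟩
  intro B
  obtain ⟨N, hN⟩ := hD B
  exact ⟨N, fun n hn => hN (φ n) (hn.trans hφ.le_apply)⟩

/-- **Composition** (kernel-checked, no `sorry` of its own): Q, P, L imply the crux
`Summit.AnomalousDissipation.AnomalousDissipation.Theses.VirtualDissipation.LambRigidGP` BY NAME — birth's join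
(landed `stub_compactnessSplit`, p85561, at `f := f_GP`, `E := 2`; smoothness of `f_GP` from the landed `stub_gpAdmissible`,
p85210) fed with D := `noOnsagerDodgerGP_of P L`; energy witness `E := 2`. -/
theorem LambRigidGP_of :
    __Registered.stub_noQuietVStateGP → __Registered.stub_badSeqPrecompactGP →
      __Registered.stub_noRoughStandingLimitGP →
      Summit.AnomalousDissipation.AnomalousDissipation.Theses.VirtualDissipation.LambRigidGP := by
  intro hQ hP hL
  have hD := noOnsagerDodgerGP_of hP hL
  dsimp only [__Registered.stub_noQuietVStateGP] at hQ
  obtain ⟨hfs, -, -⟩ :=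
    Summit.AnomalousDissipation.AnomalousDissipation.Theorems.SteadyStatesLoudBounded.GpAdmissible.stub_gpAdmissible
  obtain ⟨c, δ₀, hc, hδ₀, hrig⟩ :=
    Summit.AnomalousDissipation.AnomalousDissipation.Theorems.SteadyStatesLoudBounded.CompactnessSplit.stub_compactnessSplit
      (fun x : UnitAddTorus (Fin 3) => (Literature.Analysis.FluidPDE.Torus.stokesMode (Pi.single (2 : Fin 3) (1 : ℤ)) (EuclideanSpace.single (0 : Fin 3) (1 : ℝ)) false x + Literature.Analysis.FluidPDE.Torus.stokesMode (Pi.single (0 : Fin 3) (1 : ℤ)) (EuclideanSpace.single (1 : Fin 3) (1 : ℝ)) false x + Literature.Analysis.FluidPDE.Torus.stokesMode (Pi.single (1 : Fin 3) (1 : ℤ)) (EuclideanSpace.single (2 : Fin 3) (1 : ℝ)) false x : EuclideanSpace ℝ (Fin 3)))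
      2 hfs hQ hD
  unfold Summit.AnomalousDissipation.AnomalousDissipation.Theses.VirtualDissipation.LambRigidGP
  exact ⟨2, c, δ₀, le_refl _, hc, hδ₀, hrig⟩

/-- WIRING CHECK: the three sorried stubs compose to a closed term of the crux's type (modulo their `sorry`s).
Deliberately an `example` (no constant enters the environment). -/
example : Summit.AnomalousDissipation.AnomalousDissipation.Theses.VirtualDissipation.LambRigidGP :=
  LambRigidGP_of stub_noQuietVStateGP stub_badSeqPrecompactGP stub_noRoughStandingLimitGP

end Summit.AnomalousDissipation.AnomalousDissipation.Cruxes.LambRigidGP.ConservativeCut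

end
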